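import Summits.BirchSwinnertonDyer.BirchSwinnertonDyer.Theorems.GoldfeldAllTwistsTwoConverseTwinAdditiveDescentCorank
import Summits.BirchSwinnertonDyer.BirchSwinnertonDyer.Theorems.GoldfeldAllTwistsTwoConverseTwinAdditiveSplitPrimeTwistSelmer
import Summits.BirchSwinnertonDyer.BirchSwinnertonDyer.Theorems.GoldfeldAllTwistsTwoConverseTwinAdditiveTwoInertThreeTwistSelmer
import Summits.BirchSwinnertonDyer.BirchSwinnertonDyer.Theorems.GoldfeldAllTwistsTwoConverseTwinAdditiveTwoSplitFiveTwistSelmer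
import Summits.BirchSwinnertonDyer.BirchSwinnertonDyer.Theorems.GoldfeldAllTwistsTwoConverseTwinAdditiveTwoInertSevenTwistSelmer
import Summits.BirchSwinnertonDyer.BirchSwinnertonDyer.Theorems.GoldfeldK12AdditiveTwoSign
import HarnessLib

set_option linter.dupNamespace false -- namespace `…BirchSwinnertonDyer.BirchSwinnertonDyer…` is the cell's (D-0017 nested layout)
set_option autoImplicit false

/-!
# Route `GoldfeldAllTwistsTwoConverse`, cruxes K12₂″ (item 20044) / twin″ (item 19140): `corank_{ℤ₂} Sel_{2^∞} = 1`
# UNCONDITIONALLY on the six descent families of the additive cell — the hypothesis of K12₂″ is automatic there (part 2)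

Cell `bsd-goldfeld`, seat `bsd-goldfeld-s1p-c301` (prover, gen 3). Items: `stmt-BirchSwinnertonDyer-20044` (K12₂″,
`Theses.GoldfeldAllTwistsTwoConverse.RankOneTwoConverseCMSevenAdditiveTwo`: `corank_{ℤ₂} Sel_{2^∞}(W) = 1 ⟹
ord_{s=1} L(W, s) = 1` on the additive cell) and `stmt-BirchSwinnertonDyer-19140` (twin″). Both OPEN; nothing asserted.
Theorems only: no definition, no axiom, no `sorry`.

Seat c301 gen 2 landed COMPLETE 2-ISOGENY DESCENTS (`#S · #S' ≤ 8`) for six infinite families of negative additive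
twists of `X₀(49)` (`𝒟₋₁ = 49a1^{(−m)}`, `𝒟₋₂ = 49a1^{(−2m)}` with `m` squarefree of primes `≡ 1 (mod 4)` inert in
`ℚ(√−7)`; `𝒮 = 49a1^{(−ℓ)}`, `ℓ ≡ 5 (8)` split; `𝒯, 𝒱, 𝒰 = 49a1^{(−2ℓ)}`, `ℓ ≡ 3 (8)` inert / `≡ 5 (8)` split /
`≡ 7 (8)` inert), giving `rank ≤ 1` and `rank = 1 ⇒ Ш[2] = 0`, hence `corank = 1` GIVEN `r_an = 1` (via GZK). This
file removes the analytic input: on all six families **`corank_{ℤ₂} Sel_{2^∞}(W/ℚ) = 1` for every model `W`**, granted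
only Modularity (`hnf`), Coates–Li–Tian–Zhai Thm. 1.2 at `R = 1` (`h12`, `w(X₀(49)) = +1`) and the `2`-parity
theorem of Dokchitser–Dokchitser (`hpar`). Mechanism:

* §§1–3 (part 1, `…TwinAdditiveDescentCorank`): `#S(a,b)·#S'(a,b) ≤ 8 ⇒ corank_{ℤ₂} Sel_{2^∞}(E_{a,b}/ℚ) ≤ 1`
  (`#Ш(E)[2] ≤ #Ш(E')[φ̂]·#Ш(E)[φ] ≤ 2` in rank `0`; `Ш[2] = 0` in rank `1`).
* §4 PARITY closes the gap: a model of `49a1^{(d)}`, `d < 0`, `7 ∤ d`, has root number `−1`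
  (`rootNumber_quadraticTwist_cm7`, this seat) hence ODD corank (`hpar`), so `corank = 1`
  (`selmerCorank_two_eq_one_of_smul_eq_of_card_mul_le`); specialised to the six families with gen 2's Selmer bounds:
  `selmerCorank_two_eq_one_inertTwist / _inertTwoTwist / _splitPrimeTwist / _twoInertThreeTwist /
  _twoSplitFiveTwist / _twoInertSevenTwist`.
* §5 READING: on these families K12₂″ is EXACTLY the non-vanishing statement `L′(49a1^{(d)}, 1) ≠ 0` for every
  member (`analyticRank_eq_one_inertTwist_of_rankOneTwoConverseCMSevenAdditiveTwo`, `…inertTwoTwist…`), and with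
  gen 2's `bsdp_two_iff_shaAn_unit_*` twin″ is `#Ш_an ∈ ℤ₂^×`: the joint residue of S1⁺ on the descent families is
  the pair (`L′ ≠ 0`, `#Ш_an` a `2`-adic unit) — the shape of Coates–Li–Tian–Zhai Thm. 1.4 plus its missing `2`-part,
  for the ADDITIVE families (numerically: all `397` members with `|d| ≤ 3000` have `r_an = 1`; `Ш[2] = 0` and
  `#Ш_an ∈ {1, 9}` on the resolved ones — cell memo PRIME-TWIST-DESCENT.md).

HONEST FRAMING: no case of K12₂″ or twin″ is proved; `corank = 1` is the HYPOTHESIS of K12₂″, shown to hold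
identically on the families. Binders `hnf`, `h12`, `hpar` are published theorems (BCDT; CLTZ 2015 Thm. 1.2 case
`r = 0`; Dokchitser–Dokchitser 2010 Thm. 1.4 + Cor. 4.20).

References: J. H. Silverman, *AEC* (2009) Thm. X.4.2(a), Prop. X.4.9, Thm. III.6.1–6.2 [SilvermanAEC2009]; R.
Greenberg, LNM 1716 (1999) §1 [Greenberg1999]; T. Dokchitser, V. Dokchitser, Ann. of Math. 172 (2010) Thm. 1.4,
Cor. 4.20 [DokchitserDokchitserAnnals2010]; J. Coates, Y. Li, Y. Tian, S. Zhai, PLMS 110 (2015) Thms. 1.2, 1.4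
[CoatesLiTianZhai2015]; A. Burungale, F. Castella, C. Skinner, Y. Tian, Ann. Math. Qué. 46 (2022) Rem. D
[BurungaleCastellaSkinnerTian2022]; M. R. Murty, V. K. Murty (1997) Ch. 6 §1 [MurtyMurty1997].
-/


noncomputable section

open scoped Classical

open WeierstrassCurve Literature.NumberTheory.EllipticCurves Literature.NumberTheory.EllipticCurves.ModularForms
  Literature.NumberTheory.EllipticCurves.Rank1Residual

namespace Summit.BirchSwinnertonDyer.BirchSwinnertonDyer.Theorems.GoldfeldGoodTwists

/-! ## §4 Models of negative twists: corank exactly `1` from the descent bound and the sign -/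

section Models

/-- **`corank ≤ 1` for every model.** If `C' • W = E_{a,b}` over `ℚ` and `#S(a,b)·#S'(a,b) ≤ 8`, then
`corank_{ℤ₂} Sel_{2^∞}(W/ℚ) ≤ 1` (§3 and invariance of the corank under `ℚ`-isomorphism, `IsIsogenous.selmerCorank_eq`).
[cite: SilvermanAEC2009, Thm. X.4.2(a)] [cite: Greenberg1999, §1] -/
theorem selmerCorank_two_le_one_of_smul_eq_of_card_mul_le (W : WeierstrassCurve ℚ) [W.IsElliptic] {a b : ℤ}
    (hab : b * (a ^ 2 - 4 * b) ≠ 0) (C' : VariableChange ℚ)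
    (hE : C' • W = (⟨0, (a : ℚ), 0, (b : ℚ), 0⟩ : WeierstrassCurve ℚ))
    (hSS : (twoIsogenySelmerGroup a b).card * (twoIsogenySelmerGroup' a b).card ≤ 8) :
    W.selmerCorank 2 ≤ 1 := by
  haveI : Fact (Nat.Prime 2) := ⟨Nat.prime_two⟩
  haveI := isElliptic_mk_of_ne_zero (F := ℚ) hab
  haveI := isElliptic_halfModel hab
  rw [(isIsogenous_of_smul_eq hE).selmerCorank_eq 2]
  exact selmerCorank_two_le_one_of_card_mul_le hab hSS

/-- **`corank = 1` on a negative twist with a complete descent.** For a model `W ≅ 49a1^{(d)}`, `d < 0` squarefree,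
`7 ∤ d`, which is also `ℚ`-isomorphic to `E_{a,b}` with `#S(a,b)·#S'(a,b) ≤ 8`: `corank_{ℤ₂} Sel_{2^∞}(W/ℚ) = 1` —
`≤ 1` by the descent, odd by the sign `w(W) = −1` (`rootNumber_quadraticTwist_cm7`) and `2`-parity (`hpar`).
Granted Modularity (`hnf`), CLTZ Thm. 1.2 at `R = 1` (`h12`) and Dokchitser–Dokchitser (`hpar`).
[cite: DokchitserDokchitserAnnals2010, Thm. 1.4 and Cor. 4.20] [cite: SilvermanAEC2009, Thm. X.4.2(a)] -/
theorem selmerCorank_two_eq_one_of_smul_eq_of_card_mul_le (hnf : exists_isNewformOf)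
    (h12 : CoatesLiTianZhai2015.thm12_fullBSD_twist) (hpar : ∀ (V : WeierstrassCurve ℚ) [V.IsElliptic], p_parity V 2)
    {d : ℤ} (hsq : Squarefree d) (h7 : ¬ (7 : ℤ) ∣ d) (hd : d < 0) (W : WeierstrassCurve ℚ) [W.IsElliptic]
    (C : VariableChange ℚ) (hC : C • W = cm7.quadraticTwist (d : ℚ)) {a b : ℤ} (hab : b * (a ^ 2 - 4 * b) ≠ 0)
    (C' : VariableChange ℚ) (hE : C' • W = (⟨0, (a : ℚ), 0, (b : ℚ), 0⟩ : WeierstrassCurve ℚ))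
    (hSS : (twoIsogenySelmerGroup a b).card * (twoIsogenySelmerGroup' a b).card ≤ 8) :
    W.selmerCorank 2 = 1 := by
  have hle := selmerCorank_two_le_one_of_smul_eq_of_card_mul_le W hab C' hE hSS
  obtain ⟨k, hk⟩ := odd_selmerCorank_of_smul_eq_quadraticTwist_cm7_of_neg hnf h12 hpar hsq h7 hd W C hC
  omega

/-- A prime `l` with `(−7/l) = ±1` (i.e. `l ≠ 7`) does not divide `7`-free parameters: `¬ 7 ∣ l`. [folklore] -/
theorem not_seven_dvd_of_legendreSym_ne_zero {l : ℕ} [Fact l.Prime] (hl7 : legendreSym l (-7) ≠ 0) :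
    ¬ (7 : ℤ) ∣ (l : ℤ) := by
  have h0 : ((-7 : ℤ) : ZMod 7) = 0 := by decide
  intro h
  have hl : l.Prime := Fact.out
  have h7l : (7 : ℕ) ∣ l := by exact_mod_cast h
  have hl7' : l = 7 := ((Nat.prime_dvd_prime_iff_eq (by norm_num) hl).mp h7l).symm
  subst hl7'
  exact hl7 ((legendreSym.eq_zero_iff 7 (-7)).mpr h0)

/-! ### The six descent families of seat c301 gen 2 -/

/-- **`corank_{ℤ₂} Sel_{2^∞} = 1` UNCONDITIONALLY (mod `hnf`, `h12`, `hpar`) on `𝒟₋₁ = {49a1^{(−m)}}`**, `m ≥ 1` squarefree with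
all prime factors `≡ 1 (mod 4)` inert in `ℚ(√−7)`, every model `W`: the hypothesis of K12₂″ holds on the whole family.
[cite: DokchitserDokchitserAnnals2010, Thm. 1.4] [cite: SilvermanAEC2009, Thm. X.4.2(a), Prop. X.4.9] -/
theorem selmerCorank_two_eq_one_inertTwist (hnf : exists_isNewformOf)
    (h12 : CoatesLiTianZhai2015.thm12_fullBSD_twist) (hpar : ∀ (V : WeierstrassCurve ℚ) [V.IsElliptic], p_parity V 2)
    {m : ℕ} (hm0 : 0 < m) (hmsq : Squarefree m)
    (hinert : ∀ l : ℕ, l.Prime → l ∣ m → l % 4 = 1 ∧ ¬ IsSquare ((-7 : ℤ) : ZMod l))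
    (W : WeierstrassCurve ℚ) [W.IsElliptic] (C : VariableChange ℚ)
    (hC : C • W = cm7.quadraticTwist ((-m : ℤ) : ℚ)) : W.selmerCorank 2 = 1 := by
  have h7m : ¬ 7 ∣ m := fun h ↦ (hinert 7 (by norm_num) h).2 ⟨0, by decide⟩
  have hsq : Squarefree (-(m : ℤ)) := (Int.squarefree_natCast.mpr hmsq).squarefree_of_dvd (neg_dvd.mpr dvd_rfl)
  have h7 : ¬ (7 : ℤ) ∣ -(m : ℤ) := fun h ↦ h7m (by exact_mod_cast (dvd_neg.mp h))
  have hd : -(m : ℤ) < 0 := by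
    have : (0 : ℤ) < m := by exact_mod_cast hm0
    omega
  have hE := (smul_eq_twoTorsionModel_of_smul_eq_quadraticTwist (-m) W C hC).trans
    (show (⟨0, ((21 * (-m : ℤ) : ℤ) : ℚ), 0, ((112 * (-m : ℤ) ^ 2 : ℤ) : ℚ), 0⟩ : WeierstrassCurve ℚ) =
        ⟨0, ((-21 * m : ℤ) : ℚ), 0, ((112 * m ^ 2 : ℤ) : ℚ), 0⟩ by ext <;> push_cast <;> ring)
  have hS : (twoIsogenySelmerGroup (-21 * m) (112 * m ^ 2)).card ≤ 4 :=
    le_trans (Finset.card_le_card fun d hd =>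
      mem_of_mem_twoIsogenySelmerGroup_inertTwist hm0 hmsq (fun l hl hlm => (hinert l hl hlm).2) hd)
      Finset.card_le_four
  have hS' : (twoIsogenySelmerGroup' (-21 * m) (112 * m ^ 2)).card ≤ 2 :=
    le_trans (Finset.card_le_card fun d hd => mem_of_mem_twoIsogenySelmerGroup'_inertTwist hm0 hmsq hinert hd)
      Finset.card_le_two
  exact selmerCorank_two_eq_one_of_smul_eq_of_card_mul_le hnf h12 hpar hsq h7 hd W C hC (hab_inertTwist hm0) _ hE
    (by nlinarith)

/-- **`corank_{ℤ₂} Sel_{2^∞} = 1` on `𝒟₋₂ = {49a1^{(−2m)}}`**, same `m`, every model. [cite: DokchitserDokchitserAnnals2010, Thm. 1.4]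
[cite: SilvermanAEC2009, Thm. X.4.2(a), Prop. X.4.9] -/
theorem selmerCorank_two_eq_one_inertTwoTwist (hnf : exists_isNewformOf)
    (h12 : CoatesLiTianZhai2015.thm12_fullBSD_twist) (hpar : ∀ (V : WeierstrassCurve ℚ) [V.IsElliptic], p_parity V 2)
    {m : ℕ} (hm0 : 0 < m) (hmsq : Squarefree m)
    (hinert : ∀ l : ℕ, l.Prime → l ∣ m → l % 4 = 1 ∧ ¬ IsSquare ((-7 : ℤ) : ZMod l))
    (W : WeierstrassCurve ℚ) [W.IsElliptic] (C : VariableChange ℚ)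
    (hC : C • W = cm7.quadraticTwist ((-2 * m : ℤ) : ℚ)) : W.selmerCorank 2 = 1 := by
  have h7m : ¬ 7 ∣ m := fun h ↦ (hinert 7 (by norm_num) h).2 ⟨0, by decide⟩
  have h2m : ¬ 2 ∣ m := fun h ↦ by have := (hinert 2 Nat.prime_two h).1; omega
  have hsq : Squarefree (-2 * (m : ℤ)) := by
    have h2 : Squarefree (((2 * m : ℕ) : ℤ)) := Int.squarefree_natCast.mpr
      ((Nat.squarefree_mul ((Nat.prime_two.coprime_iff_not_dvd).mpr h2m)).mpr ⟨Nat.squarefree_two, hmsq⟩)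
    exact h2.squarefree_of_dvd ⟨-1, by push_cast; ring⟩
  have h7 : ¬ (7 : ℤ) ∣ -2 * (m : ℤ) := by
    intro h
    rcases (Int.Prime.dvd_mul' (by norm_num) h) with h2 | hm
    · norm_num at h2
    · exact h7m (by exact_mod_cast hm)
  have hd : -2 * (m : ℤ) < 0 := by
    have : (0 : ℤ) < m := by exact_mod_cast hm0
    omega
  have hE := (smul_eq_twoTorsionModel_of_smul_eq_quadraticTwist (-2 * m) W C hC).trans
    (show (⟨0, ((21 * (-2 * m : ℤ) : ℤ) : ℚ), 0, ((112 * (-2 * m : ℤ) ^ 2 : ℤ) : ℚ), 0⟩ : WeierstrassCurve ℚ) =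
        ⟨0, ((-42 * m : ℤ) : ℚ), 0, ((448 * m ^ 2 : ℤ) : ℚ), 0⟩ by ext <;> push_cast <;> ring)
  have hS : (twoIsogenySelmerGroup (-42 * m) (448 * m ^ 2)).card ≤ 4 :=
    le_trans (Finset.card_le_card fun d hd => mem_of_mem_twoIsogenySelmerGroup_inertTwoTwist hm0 hmsq hinert hd)
      Finset.card_le_four
  have hS' : (twoIsogenySelmerGroup' (-42 * m) (448 * m ^ 2)).card ≤ 2 :=
    le_trans (Finset.card_le_card fun d hd => mem_of_mem_twoIsogenySelmerGroup'_inertTwoTwist hm0 hmsq hinert hd)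
      Finset.card_le_two
  exact selmerCorank_two_eq_one_of_smul_eq_of_card_mul_le hnf h12 hpar hsq h7 hd W C hC (hab_inertTwoTwist hm0) _ hE
    (by nlinarith)

/-- Bookkeeping for the prime families `49a1^{(−ℓ)}`: `−ℓ < 0` squarefree, `7 ∤ −ℓ`, and the two-torsion model. [folklore] -/
theorem primeTwist_data {l : ℕ} [Fact l.Prime] (hl7 : legendreSym l (-7) ≠ 0) (W : WeierstrassCurve ℚ)
    (C : VariableChange ℚ) (hC : C • W = cm7.quadraticTwist ((-l : ℤ) : ℚ)) :
    Squarefree (-(l : ℤ)) ∧ ¬ (7 : ℤ) ∣ -(l : ℤ) ∧ -(l : ℤ) < 0 ∧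
      ((⟨(Units.mk0 (2 : ℚ) two_ne_zero)⁻¹, 2 * ((-l : ℤ) : ℚ), 0, 0⟩ : VariableChange ℚ) * C) • W =
        (⟨0, ((-21 * l : ℤ) : ℚ), 0, ((112 * l ^ 2 : ℤ) : ℚ), 0⟩ : WeierstrassCurve ℚ) := by
  have hl : l.Prime := Fact.out
  refine ⟨(Int.squarefree_natCast.mpr hl.squarefree).squarefree_of_dvd (neg_dvd.mpr dvd_rfl),
    fun h ↦ not_seven_dvd_of_legendreSym_ne_zero hl7 (dvd_neg.mp h),
    by have : (0 : ℤ) < l := (by exact_mod_cast hl.pos); omega, ?_⟩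
  exact (smul_eq_twoTorsionModel_of_smul_eq_quadraticTwist (-l) W C hC).trans
    (show (⟨0, ((21 * (-l : ℤ) : ℤ) : ℚ), 0, ((112 * (-l : ℤ) ^ 2 : ℤ) : ℚ), 0⟩ : WeierstrassCurve ℚ) =
        ⟨0, ((-21 * l : ℤ) : ℚ), 0, ((112 * l ^ 2 : ℤ) : ℚ), 0⟩ by ext <;> push_cast <;> ring)

/-- Bookkeeping for the prime families `49a1^{(−2ℓ)}` (`ℓ` odd). [folklore] -/
theorem twoPrimeTwist_data {l : ℕ} [Fact l.Prime] (hl2 : l ≠ 2) (hl7 : legendreSym l (-7) ≠ 0)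
    (W : WeierstrassCurve ℚ) (C : VariableChange ℚ) (hC : C • W = cm7.quadraticTwist ((-2 * l : ℤ) : ℚ)) :
    Squarefree (-2 * (l : ℤ)) ∧ ¬ (7 : ℤ) ∣ -2 * (l : ℤ) ∧ -2 * (l : ℤ) < 0 ∧
      ((⟨(Units.mk0 (2 : ℚ) two_ne_zero)⁻¹, 2 * ((-2 * l : ℤ) : ℚ), 0, 0⟩ : VariableChange ℚ) * C) • W =
        (⟨0, ((-42 * l : ℤ) : ℚ), 0, ((448 * l ^ 2 : ℤ) : ℚ), 0⟩ : WeierstrassCurve ℚ) := by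
  have hl : l.Prime := Fact.out
  have h2l : ¬ 2 ∣ l := fun h ↦ hl2 ((Nat.prime_dvd_prime_iff_eq Nat.prime_two hl).mp h).symm
  refine ⟨?_, ?_, by have : (0 : ℤ) < l := (by exact_mod_cast hl.pos); omega, ?_⟩
  · have h2 : Squarefree (((2 * l : ℕ) : ℤ)) := Int.squarefree_natCast.mpr
      ((Nat.squarefree_mul ((Nat.prime_two.coprime_iff_not_dvd).mpr h2l)).mpr ⟨Nat.squarefree_two, hl.squarefree⟩)
    exact h2.squarefree_of_dvd ⟨-1, by push_cast; ring⟩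
  · intro h
    rcases (Int.Prime.dvd_mul' (by norm_num) h) with h2 | hm
    · norm_num at h2
    · exact not_seven_dvd_of_legendreSym_ne_zero hl7 hm
  · exact (smul_eq_twoTorsionModel_of_smul_eq_quadraticTwist (-2 * l) W C hC).trans
      (show (⟨0, ((21 * (-2 * l : ℤ) : ℤ) : ℚ), 0, ((112 * (-2 * l : ℤ) ^ 2 : ℤ) : ℚ), 0⟩ : WeierstrassCurve ℚ) =
          ⟨0, ((-42 * l : ℤ) : ℚ), 0, ((448 * l ^ 2 : ℤ) : ℚ), 0⟩ by ext <;> push_cast <;> ring)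

/-- **`corank_{ℤ₂} Sel_{2^∞} = 1` on `𝒮 = {49a1^{(−ℓ)} : ℓ ≡ 5 (mod 8) split in ℚ(√−7)}`**, every model.
[cite: DokchitserDokchitserAnnals2010, Thm. 1.4] [cite: SilvermanAEC2009, Thm. X.4.2(a), Prop. X.4.9] -/
theorem selmerCorank_two_eq_one_splitPrimeTwist (hnf : exists_isNewformOf)
    (h12 : CoatesLiTianZhai2015.thm12_fullBSD_twist) (hpar : ∀ (V : WeierstrassCurve ℚ) [V.IsElliptic], p_parity V 2)
    {l : ℕ} [Fact l.Prime] (hl8 : l % 8 = 5) (hl7 : legendreSym l (-7) = 1)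
    (W : WeierstrassCurve ℚ) [W.IsElliptic] (C : VariableChange ℚ)
    (hC : C • W = cm7.quadraticTwist ((-l : ℤ) : ℚ)) : W.selmerCorank 2 = 1 := by
  obtain ⟨hsq, h7, hd, hE⟩ := primeTwist_data (by rw [hl7]; decide) W C hC
  have hS := card_twoIsogenySelmerGroup_splitPrimeTwist_le hl8 hl7
  have hS' := card_twoIsogenySelmerGroup'_splitPrimeTwist_le hl8 hl7
  exact selmerCorank_two_eq_one_of_smul_eq_of_card_mul_le hnf h12 hpar hsq h7 hd W C hC
    (hab_inertTwist (Fact.out : l.Prime).pos) _ hE (by nlinarith)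

/-- **`corank_{ℤ₂} Sel_{2^∞} = 1` on `𝒯 = {49a1^{(−2ℓ)} : ℓ ≡ 3 (mod 8) inert}`**, every model.
[cite: DokchitserDokchitserAnnals2010, Thm. 1.4] [cite: SilvermanAEC2009, Thm. X.4.2(a), Prop. X.4.9] -/
theorem selmerCorank_two_eq_one_twoInertThreeTwist (hnf : exists_isNewformOf)
    (h12 : CoatesLiTianZhai2015.thm12_fullBSD_twist) (hpar : ∀ (V : WeierstrassCurve ℚ) [V.IsElliptic], p_parity V 2)
    {l : ℕ} [Fact l.Prime] (hl8 : l % 8 = 3) (hl7 : legendreSym l (-7) = -1)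
    (W : WeierstrassCurve ℚ) [W.IsElliptic] (C : VariableChange ℚ)
    (hC : C • W = cm7.quadraticTwist ((-2 * l : ℤ) : ℚ)) : W.selmerCorank 2 = 1 := by
  obtain ⟨hsq, h7, hd, hE⟩ := twoPrimeTwist_data (by rintro rfl; norm_num at hl8) (by rw [hl7]; decide) W C hC
  have hS := card_twoIsogenySelmerGroup_twoInertThreeTwist_le hl8 hl7
  have hS' := card_twoIsogenySelmerGroup'_twoInertThreeTwist_le hl8 hl7
  exact selmerCorank_two_eq_one_of_smul_eq_of_card_mul_le hnf h12 hpar hsq h7 hd W C hC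
    (hab_inertTwoTwist (Fact.out : l.Prime).pos) _ hE (by nlinarith)

/-- **`corank_{ℤ₂} Sel_{2^∞} = 1` on `𝒱 = {49a1^{(−2ℓ)} : ℓ ≡ 5 (mod 8) split}`**, every model.
[cite: DokchitserDokchitserAnnals2010, Thm. 1.4] [cite: SilvermanAEC2009, Thm. X.4.2(a), Prop. X.4.9] -/
theorem selmerCorank_two_eq_one_twoSplitFiveTwist (hnf : exists_isNewformOf)
    (h12 : CoatesLiTianZhai2015.thm12_fullBSD_twist) (hpar : ∀ (V : WeierstrassCurve ℚ) [V.IsElliptic], p_parity V 2)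
    {l : ℕ} [Fact l.Prime] (hl8 : l % 8 = 5) (hl7 : legendreSym l (-7) = 1)
    (W : WeierstrassCurve ℚ) [W.IsElliptic] (C : VariableChange ℚ)
    (hC : C • W = cm7.quadraticTwist ((-2 * l : ℤ) : ℚ)) : W.selmerCorank 2 = 1 := by
  obtain ⟨hsq, h7, hd, hE⟩ := twoPrimeTwist_data (by rintro rfl; norm_num at hl8) (by rw [hl7]; decide) W C hC
  have hS := card_twoIsogenySelmerGroup_twoSplitFiveTwist_le hl8 hl7
  have hS' := card_twoIsogenySelmerGroup'_twoSplitFiveTwist_le hl8 hl7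
  exact selmerCorank_two_eq_one_of_smul_eq_of_card_mul_le hnf h12 hpar hsq h7 hd W C hC
    (hab_inertTwoTwist (Fact.out : l.Prime).pos) _ hE (by nlinarith)

/-- **`corank_{ℤ₂} Sel_{2^∞} = 1` on `𝒰 = {49a1^{(−2ℓ)} : ℓ ≡ 7 (mod 8) inert}`**, every model.
[cite: DokchitserDokchitserAnnals2010, Thm. 1.4] [cite: SilvermanAEC2009, Thm. X.4.2(a), Prop. X.4.9] -/
theorem selmerCorank_two_eq_one_twoInertSevenTwist (hnf : exists_isNewformOf)
    (h12 : CoatesLiTianZhai2015.thm12_fullBSD_twist) (hpar : ∀ (V : WeierstrassCurve ℚ) [V.IsElliptic], p_parity V 2)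
    {l : ℕ} [Fact l.Prime] (hl8 : l % 8 = 7) (hl7 : legendreSym l (-7) = -1)
    (W : WeierstrassCurve ℚ) [W.IsElliptic] (C : VariableChange ℚ)
    (hC : C • W = cm7.quadraticTwist ((-2 * l : ℤ) : ℚ)) : W.selmerCorank 2 = 1 := by
  obtain ⟨hsq, h7, hd, hE⟩ := twoPrimeTwist_data (by rintro rfl; norm_num at hl8) (by rw [hl7]; decide) W C hC
  have hS := card_twoIsogenySelmerGroup_twoInertSevenTwist_le hl8 hl7
  have hS' := card_twoIsogenySelmerGroup'_twoInertSevenTwist_le hl8 hl7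
  exact selmerCorank_two_eq_one_of_smul_eq_of_card_mul_le hnf h12 hpar hsq h7 hd W C hC
    (hab_inertTwoTwist (Fact.out : l.Prime).pos) _ hE (by nlinarith)

end Models

/-! ## §5 Reading for the cruxes: on the descent families K12₂″ is a pure non-vanishing statement -/

/-- **K12₂″ on `𝒟₋₁` is the non-vanishing statement `L′(49a1^{(−m)}, 1) ≠ 0`.** Granted Modularity, CLTZ 1.2 at
`R = 1` and `2`-parity: since `corank_{ℤ₂} Sel_{2^∞}(W) = 1` holds for EVERY globally minimal model `W` of every
`49a1^{(−m)}` (`m ≥ 1` squarefree, prime factors `≡ 1 (mod 4)` inert in `ℚ(√−7)`), the crux K12₂″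
(`Theses.GoldfeldAllTwistsTwoConverse.RankOneTwoConverseCMSevenAdditiveTwo`) asserts there exactly
`ord_{s=1} L(W, s) = 1` for all of them (their root number is `−1`, so this is `L′(W, 1) ≠ 0`). With seat c301
gen 2's `bsdp_two_iff_shaAn_unit_inertTwist`, the two open cruxes of S1⁺ on `𝒟₋₁` read:
`L′(49a1^{(−m)}, 1) ≠ 0` and `#Ш_an(49a1^{(−m)}) ∈ ℤ₂^×`. [cite: DokchitserDokchitserAnnals2010, Thm. 1.4]
[cite: BurungaleCastellaSkinnerTian2022, Rem. D] -/
theorem analyticRank_eq_one_inertTwist_of_rankOneTwoConverseCMSevenAdditiveTwo (hnf : exists_isNewformOf)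
    (h12 : CoatesLiTianZhai2015.thm12_fullBSD_twist) (hpar : ∀ (V : WeierstrassCurve ℚ) [V.IsElliptic], p_parity V 2)
    (hK : Summit.BirchSwinnertonDyer.BirchSwinnertonDyer.Theses.GoldfeldAllTwistsTwoConverse.RankOneTwoConverseCMSevenAdditiveTwo)
    {m : ℕ} (hm0 : 0 < m) (hmsq : Squarefree m)
    (hinert : ∀ l : ℕ, l.Prime → l ∣ m → l % 4 = 1 ∧ ¬ IsSquare ((-7 : ℤ) : ZMod l))
    (W : WeierstrassCurve ℚ) [W.IsElliptic] [W.IsGloballyMinimal] (C : VariableChange ℚ)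
    (hC : C • W = cm7.quadraticTwist ((-m : ℤ) : ℚ)) : W.analyticRank = 1 := by
  have h7m : ¬ 7 ∣ m := fun h ↦ (hinert 7 (by norm_num) h).2 ⟨0, by decide⟩
  have hsq : Squarefree (-(m : ℤ)) := (Int.squarefree_natCast.mpr hmsq).squarefree_of_dvd (neg_dvd.mpr dvd_rfl)
  have h7 : ¬ (7 : ℤ) ∣ -(m : ℤ) := fun h ↦ h7m (by exact_mod_cast (dvd_neg.mp h))
  have hd : -(m : ℤ) < 0 := by
    have : (0 : ℤ) < m := by exact_mod_cast hm0
    omega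
  have hm4 : (-(m : ℤ)) % 4 ≠ 1 := by
    have := mod_four_eq_one_of_forall_prime hm0 fun l hl hlm => (hinert l hl hlm).1
    omega
  exact negTwists_of_rankOneTwoConverseCMSevenAdditiveTwo hK (-m) hd hsq h7 hm4 W C hC
    (selmerCorank_two_eq_one_inertTwist hnf h12 hpar hm0 hmsq hinert W C hC)

/-- **K12₂″ on `𝒟₋₂` is `L′(49a1^{(−2m)}, 1) ≠ 0`** (same `m`, every globally minimal model).
[cite: DokchitserDokchitserAnnals2010, Thm. 1.4] [cite: BurungaleCastellaSkinnerTian2022, Rem. D] -/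
theorem analyticRank_eq_one_inertTwoTwist_of_rankOneTwoConverseCMSevenAdditiveTwo (hnf : exists_isNewformOf)
    (h12 : CoatesLiTianZhai2015.thm12_fullBSD_twist) (hpar : ∀ (V : WeierstrassCurve ℚ) [V.IsElliptic], p_parity V 2)
    (hK : Summit.BirchSwinnertonDyer.BirchSwinnertonDyer.Theses.GoldfeldAllTwistsTwoConverse.RankOneTwoConverseCMSevenAdditiveTwo)
    {m : ℕ} (hm0 : 0 < m) (hmsq : Squarefree m)
    (hinert : ∀ l : ℕ, l.Prime → l ∣ m → l % 4 = 1 ∧ ¬ IsSquare ((-7 : ℤ) : ZMod l))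
    (W : WeierstrassCurve ℚ) [W.IsElliptic] [W.IsGloballyMinimal] (C : VariableChange ℚ)
    (hC : C • W = cm7.quadraticTwist ((-2 * m : ℤ) : ℚ)) : W.analyticRank = 1 := by
  have h7m : ¬ 7 ∣ m := fun h ↦ (hinert 7 (by norm_num) h).2 ⟨0, by decide⟩
  have h2m : ¬ 2 ∣ m := fun h ↦ by have := (hinert 2 Nat.prime_two h).1; omega
  have hsq : Squarefree (-2 * (m : ℤ)) := by
    have h2 : Squarefree (((2 * m : ℕ) : ℤ)) := Int.squarefree_natCast.mpr
      ((Nat.squarefree_mul ((Nat.prime_two.coprime_iff_not_dvd).mpr h2m)).mpr ⟨Nat.squarefree_two, hmsq⟩)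
    exact h2.squarefree_of_dvd ⟨-1, by push_cast; ring⟩
  have h7 : ¬ (7 : ℤ) ∣ -2 * (m : ℤ) := by
    intro h
    rcases (Int.Prime.dvd_mul' (by norm_num) h) with h2 | hm
    · norm_num at h2
    · exact h7m (by exact_mod_cast hm)
  have hd : -2 * (m : ℤ) < 0 := by
    have : (0 : ℤ) < m := by exact_mod_cast hm0
    omega
  have hm4 : (-2 * (m : ℤ)) % 4 ≠ 1 := by omega
  exact negTwists_of_rankOneTwoConverseCMSevenAdditiveTwo hK (-2 * m) hd hsq h7 hm4 W C hC
    (selmerCorank_two_eq_one_inertTwoTwist hnf h12 hpar hm0 hmsq hinert W C hC)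

end Summit.BirchSwinnertonDyer.BirchSwinnertonDyer.Theorems.GoldfeldGoodTwists

end
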